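import Summits.ResolutionOfSingularities.ResolutionOfSingularities.Theorems.FrobeniusLadderFRationalResolutionIsolatedAffineLogRegularChartResolution
import Summits.ResolutionOfSingularities.ResolutionOfSingularities.Theorems.FrobeniusLadderFRationalResolutionSharpChart
import Summits.ResolutionOfSingularities.ResolutionOfSingularities.Theorems.FrobeniusLadderFRationalResolutionSharpRank
import Summits.ResolutionOfSingularities.ResolutionOfSingularities.Theorems.FrobeniusLadderFRationalResolutionLogChartUnitTransfer
import Summits.ResolutionOfSingularities.ResolutionOfSingularities.Theorems.FrobeniusLadderFRationalResolutionSimplicialNormalization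
import Summits.ResolutionOfSingularities.ResolutionOfSingularities.Theorems.FrobeniusLadderFRationalResolutionEtaleLocalLogRegular
import Summits.ResolutionOfSingularities.ResolutionOfSingularities.Theorems.FrobeniusLadderFRationalResolutionDiagQuotientSurface
import HarnessLib

/-!
# Crux `FrobeniusLadder.FRationalResolution` (stmt-ResolutionOfSingularities-15317), line `redirect`,
# stub `stub_diagonalizableQuotientResolution` — **ISOLATED diagonalizable quotient singularities over an algebraically closed
# field ARE RESOLVABLE, tame or WILD**, and hence **diagonalizable quotient SURFACE singularities over `K = K̄` are resolvable**
# (the stub's hypothesis `hq` verbatim; no tameness, no fixed-point condition)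

The «sharpening» step assembled (memo MEMO-15317-leafhand4-g1 §remaining (1), all bricks ✓ this generation): at an ARBITRARY point
of a quotient chart `Spec S₀`, `…WildLogRegularNhd.exists_nhd_isLogRegularAt_of_units` (after the étale localization of
`…AwayUnits` / `…FixedChart.etale_locPieceZeroHom`) gives the unit-exponent chart `ψ(p) = ∏ y_l^{p_l}` on `P(c)`, log regular on
`D(g)`; splitting the exponents into `y_l ∈ 𝔔` / `y_l ∉ 𝔔` and inverting `h = ψ(0, ord)`, the sharpened chart `ψ♯` of
`…SharpChart` on `P(c♯)` (`…SharpProjection`, `…SharpSection`) agrees with `ψ` up to units, so Kato's (2.1) transfers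
(`…LogChartUnitTransfer` with the rank identity `…SharpRank`); `ψ♯` has unit face `0` at the point, and its normalisation
(`…SimplicialNormalization`) is fs, spanning, primitively simplicial. These are the ring data of
`…IsolatedAffineLogRegularChartResolution.hasResolution_of_isolated_affine_logRegular_charts_of_isAlgClosed'` (dimension
hypothesis removed by `…RegularPointRegularCone`).

* `exists_sharp_affine_chart` — ring level: at every point `v` of `Spec S₀` an étale `S₀ → R`, a prime `w` over `v`, and an fs
  spanning primitively-simplicial chart `χ : P → R`, log regular on `D(g) ∋ w`, with `χ(P ∖ 0) ⊆ w`;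
* **`hasResolution_of_isolated_quotient_charts_of_isAlgClosed`** — `X` integral, locally of finite type over `K = K̄`, finitely
  many singular points, each in the image of an étale quotient chart `Spec S₀ → X` (`S` regular of finite type over `K` graded by a
  finite abelian group `A`, ANY `A`) ⇒ `Scheme.HasResolution X`;
* **`hasResolution_of_quotient_surface_of_isAlgClosed`** — the stub's `hq` VERBATIM + `K = K̄` + `dim X ≤ 2` ⇒ `Scheme.HasResolution X`.

Honest label: the ISOLATED slice (all dimensions) and the SURFACE slice of `stub_diagonalizableQuotientResolution` over
algebraically closed fields, PROVED; no stub closed by name (the stub allows any field and non-isolated singular loci — the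
remaining gap is the gluing = Bergh–Rydh destackification, and a residue-field-free E-k). No definitions, no named facts, no sorry.
[cite: Kato1994, (1.5), Def. (2.1), Prop. (7.1), (10.4)] [cite: KempfEtAl1973, Ch. I §2 Thm. 11] [cite: Kollar2007, §2.2]
[cite: Lipman1978, §2] [folklore; cite: SGA3, Exp. VIII §4–5]
-/

noncomputable section

-- single-problem summit: the doubled namespace component is forced
set_option linter.dupNamespace false

open CategoryTheory AlgebraicGeometry
open Literature.RingTheory.GradedAlgebra
open Literature.AlgebraicGeometry.Resolution Literature.Geometry.PolyhedralFans
open Literature.AlgebraicGeometry.Resolution.LogBlowup Literature.AlgebraicGeometry.Resolution.LogChart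
open Literature.AlgebraicGeometry.Resolution.DiagonalizableQuotient
open Summit.ResolutionOfSingularities.ResolutionOfSingularities.Theorems.FRationalResolution

namespace Summit.ResolutionOfSingularities.ResolutionOfSingularities.Theorems.FRationalResolution.IsolatedQuotientResolution

/-- **The sharpening package over a localization (generic).** `ψ : P(c) → T` a chart whose value at `p` lies in the prime
`𝔮₀` iff some `inl`-exponent of `p` is positive (the `inl`-coordinates of the splitting `e` are the «non-unit» ones), log
regular on `D(g) ∌ 𝔮₀`; `z = (0, ord) ∈ P(c)` and `R` a localization of `T` inverting `ψ(z)`. Then `R` carries an fs spanning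
primitively-simplicial chart `χ`, log regular on `D(g)`, with unit face `0` at the prime `w = 𝔮₀R`.
[cite: Kato1994, (1.5), Def. (2.1)] -/
theorem sharp_chart_of_isLocalization {T : Type} [CommRing T] {A : Type} [AddCommGroup A] {N n m : ℕ}
    (e : Fin n ⊕ Fin m ≃ Fin N) (c : Fin N → A) (hc : ∀ l, IsOfFinAddOrder (c l))
    (ψ : Multiplicative ↥(AddSubmonoid.nonneg (Fin N → ℤ) ⊓
      AddMonoidHom.mker (Fintype.linearCombination ℤ c).toAddMonoidHom) →* T)
    (𝔮₀ : Ideal T) [𝔮₀.IsPrime]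
    (hψ_mem : ∀ p, ψ (Multiplicative.ofAdd p) ∈ 𝔮₀ ↔ ∃ i, 0 < ((p : Fin N → ℤ) (e (Sum.inl i))).toNat)
    (g : T) (hg : g ∉ 𝔮₀)
    (hreg : ∀ (𝔭 : Ideal T) [𝔭.IsPrime], g ∉ 𝔭 → IsLogRegularAt _ ψ 𝔭)
    (z : ↥(AddSubmonoid.nonneg (Fin N → ℤ) ⊓ AddMonoidHom.mker (Fintype.linearCombination ℤ c).toAddMonoidHom))
    (hz₁ : ∀ i, (z : Fin N → ℤ) (e (Sum.inl i)) = 0)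
    (hz₂ : ∀ j, (z : Fin N → ℤ) (e (Sum.inr j)) = (addOrderOf (c (e (Sum.inr j))) : ℤ))
    (R : Type) [CommRing R] [Algebra T R] [IsLocalization.Away (ψ (Multiplicative.ofAdd z)) R]
    {S₀ : Type} [CommRing S₀] (j : S₀ →+* T) (hj : j.Etale) :
    ((algebraMap T R).comp j).Etale ∧
    ∃ (w : PrimeSpectrum R), w.asIdeal.comap (algebraMap T R) = 𝔮₀ ∧
      ∃ (P : AddSubmonoid (Fin n → ℤ)) (hP : P.FG) (_ : ∀ (u : Fin n → ℤ) (K : ℕ), 0 < K → K • u ∈ P → u ∈ P)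
        (hspan : Submodule.span ℤ (P : Set (Fin n → ℤ)) = ⊤) (χ : Multiplicative P →* R),
        algebraMap T R g ∉ w.asIdeal ∧ (∀ (𝔭 : Ideal R) [𝔭.IsPrime], algebraMap T R g ∉ 𝔭 → IsLogRegularAt P χ 𝔭) ∧
        (∀ p : P, (p : Fin n → ℤ) ≠ 0 → χ (Multiplicative.ofAdd p) ∈ w.asIdeal) ∧
        (Fan.ofCone (dualCone P) (dualCone_fg P hP) (isSalient_dualCone P hspan)).IsPrimSimplicial := by
  classical
  -- `h = ψ(z) ∉ 𝔮₀`, the prime `w = 𝔮₀ R`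
  have hh𝔮₀ : ψ (Multiplicative.ofAdd z) ∉ 𝔮₀ := by
    rw [hψ_mem]
    rintro ⟨i, hi⟩
    rw [hz₁ i] at hi
    exact absurd hi (by decide)
  have hdisj : Disjoint (↑(Submonoid.powers (ψ (Multiplicative.ofAdd z))) : Set T) (𝔮₀ : Set T) := by
    refine Set.disjoint_left.mpr ?_
    rintro _ ⟨K, rfl⟩ hK
    exact hh𝔮₀ (Ideal.IsPrime.mem_of_pow_mem inferInstance _ hK)
  haveI hwprime : (𝔮₀.map (algebraMap T R)).IsPrime :=
    IsLocalization.isPrime_of_isPrime_disjoint (Submonoid.powers _) R 𝔮₀ inferInstance hdisj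
  let w : PrimeSpectrum R := ⟨𝔮₀.map (algebraMap T R), hwprime⟩
  have hw₀ : w.asIdeal.comap (algebraMap T R) = 𝔮₀ :=
    IsLocalization.under_map_of_isPrime_disjoint (Submonoid.powers _) R inferInstance hdisj
  have hunit : IsUnit (algebraMap T R (ψ (Multiplicative.ofAdd z))) :=
    IsLocalization.Away.algebraMap_isUnit (ψ (Multiplicative.ofAdd z))
  -- the sharpened chart
  obtain ⟨π, ψs, hπapply, hπsurj, hrel, hformula, hvert⟩ := SharpChart.exists_sharp_chart e c hc ψ z hz₁ hz₂ R
  let ψR : Multiplicative ↥(AddSubmonoid.nonneg (Fin N → ℤ) ⊓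
      AddMonoidHom.mker (Fintype.linearCombination ℤ c).toAddMonoidHom) →* R :=
    (algebraMap T R).toMonoidHom.comp ψ
  have hrel' : ∀ p, ∃ u : R, IsUnit u ∧ ψR (Multiplicative.ofAdd p) = ψs (Multiplicative.ofAdd (π p)) * u := hrel
  -- the rank identity at every prime of `R`
  have hrank : ∀ (𝔓 : Ideal R) [𝔓.IsPrime],
      N - Module.finrank ℤ (Submodule.span ℤ ((fun p : ↥(AddSubmonoid.nonneg (Fin N → ℤ) ⊓
          AddMonoidHom.mker (Fintype.linearCombination ℤ c).toAddMonoidHom) => (p : Fin N → ℤ)) '' face _ ψR 𝔓)) =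
        n - Module.finrank ℤ (Submodule.span ℤ
          ((fun p : ↥(AddSubmonoid.nonneg (Fin n → ℤ) ⊓
            AddMonoidHom.mker (Fintype.linearCombination ℤ (fun i : Fin n => (Submodule.span ℤ
              (Set.range fun j' => c (e (Sum.inr j')))).mkQ (c (e (Sum.inl i))))).toAddMonoidHom) =>
            (p : Fin n → ℤ)) '' face _ ψs 𝔓)) := by
    intro 𝔓 _
    have hface := LogChartUnitTransfer.face_eq_preimage ψR ψs π 𝔓 hrel'
    refine SharpRank.rank_term_eq e _ _ ?_ (fun j' => (addOrderOf (c (e (Sum.inr j'))) : ℤ))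
      (fun j' => by exact_mod_cast (hc _).addOrderOf_pos.ne') ?_
    · -- the face of `ψR` projects onto the face of `ψs`
      ext mvec
      constructor
      · rintro ⟨_, ⟨p, hp, rfl⟩, rfl⟩
        rw [hface] at hp
        exact ⟨π p, hp, funext fun i => by simp only [hπapply]⟩
      · rintro ⟨ms, hms, rfl⟩
        obtain ⟨p, rfl⟩ := hπsurj ms
        exact ⟨(p : Fin N → ℤ), ⟨p, by rw [hface]; exact hms, rfl⟩, funext fun i => by simp only [hπapply]⟩
    · -- the vertical generators lie in the face (they map to units)
      intro j'
      obtain ⟨zj, hzj₁, hzj₂, hzju⟩ := hvert j'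
      refine ⟨zj, ?_, ?_⟩
      · show ψR (Multiplicative.ofAdd zj) ∉ 𝔓
        exact fun hmem => ‹𝔓.IsPrime›.ne_top (Ideal.eq_top_of_isUnit_mem _ hmem hzju)
      · funext l
        dsimp only
        obtain ⟨x, rfl⟩ := e.surjective l
        rcases x with i | j''
        · rw [hzj₁ i]
          have : e (Sum.inl i) ≠ e (Sum.inr j') := fun h => Sum.inl_ne_inr (e.injective h)
          simp [this]
        · rw [hzj₂ j'']
          by_cases hjj : j'' = j'
          · subst hjj; simp
          · have : e (Sum.inr j'') ≠ e (Sum.inr j') := fun h => hjj (Sum.inr_injective (e.injective h))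
            simp [hjj, this]
  -- Kato's (2.1) for the sharpened chart on `D(g)`
  have hregs : ∀ (𝔓 : Ideal R) [𝔓.IsPrime], algebraMap T R g ∉ 𝔓 → IsLogRegularAt _ ψs 𝔓 := by
    intro 𝔓 _ hg𝔓
    have hg' : g ∉ 𝔓.comap (algebraMap T R) := fun h => hg𝔓 (Ideal.mem_comap.mp h)
    have h1 : IsLogRegularAt _ ψR 𝔓 :=
      FixedPointResolvableNhd.isLogRegularAt_of_isLocalization (Submonoid.powers (ψ (Multiplicative.ofAdd z))) _ ψ 𝔓
        (hreg _ hg')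
    exact LogChartUnitTransfer.isLogRegularAt_of_units ψR ψs π 𝔓 hπsurj hrel' (hrank 𝔓) h1
  -- normalisation: fs, spanning, primitively simplicial
  have hcs : ∀ i, IsOfFinAddOrder ((Submodule.span ℤ (Set.range fun j' => c (e (Sum.inr j')))).mkQ (c (e (Sum.inl i)))) :=
    fun i => (Submodule.span ℤ (Set.range fun j' => c (e (Sum.inr j')))).mkQ.toAddMonoidHom.isOfFinAddOrder (hc _)
  obtain ⟨P', e', hfg', hsat', hspan', hiff, hps⟩ :=
    SimplicialNormalization.exists_normalized_chart_forall_isPrimSimplicial _ hcs ψs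
  have hιet : ((algebraMap T R).comp j).Etale :=
    RingHom.Etale.stableUnderComposition j (algebraMap T R) hj
      (RingHom.etale_algebraMap.mpr (Algebra.Etale.of_isLocalizationAway (ψ (Multiplicative.ofAdd z))))
  refine ⟨hιet, w, hw₀, P', hfg', fun u K hK hKu => (hsat' hKu).resolve_left (Nat.pos_iff_ne_zero.mp hK), hspan',
    ψs.comp (AddMonoidHom.toMultiplicative e'.toAddMonoidHom), ?_, ?_, ?_, hps⟩
  · rw [← Ideal.mem_comap, hw₀]
    exact hg
  · intro 𝔭 _ hg𝔭
    exact (hiff 𝔭).mpr (hregs 𝔭 hg𝔭)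
  · -- unit face `0` at `w`
    intro p hp
    have hep : ((e' p : _) : Fin n → ℤ) ≠ 0 := fun h0 => hp (by
      have h1 : e' p = 0 := Subtype.ext h0
      have h2 : p = 0 := (map_eq_zero_iff e' e'.injective).mp h1
      rw [h2]; rfl)
    change ψs (Multiplicative.ofAdd (e' p)) ∈ w.asIdeal
    obtain ⟨vlift, K, hvl, hvK⟩ := hformula (e' p)
    have hmem : algebraMap T R (ψ (Multiplicative.ofAdd vlift)) ∈ w.asIdeal := by
      apply Ideal.mem_map_of_mem
      rw [hψ_mem]
      obtain ⟨i, hi⟩ : ∃ i, ((e' p : _) : Fin n → ℤ) i ≠ 0 := by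
        by_contra hall
        push Not at hall
        exact hep (funext hall)
      have h0 : (0 : ℤ) ≤ ((e' p : _) : Fin n → ℤ) i :=
        (AddSubmonoid.mem_nonneg.mp (AddSubmonoid.mem_inf.mp (e' p).2).1) i
      refine ⟨i, ?_⟩
      rw [hvl i]
      omega
    rw [← hvK] at hmem
    rcases ‹w.asIdeal.IsPrime›.mem_or_mem hmem with h | h
    · exact h
    · exact absurd (Ideal.IsPrime.mem_of_pow_mem inferInstance _ h)
        fun hmem' => ‹w.asIdeal.IsPrime›.ne_top (Ideal.eq_top_of_isUnit_mem _ hmem' hunit)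

/-- **Ring level: the sharpened fs chart at an arbitrary point of a quotient chart.** `S` regular of finite type over a field
`k`, graded by a finite abelian group `A` (tame or wild), `v` any point of `Spec S₀`. There are an étale `ι : S₀ → R`, a prime `w`
of `R` over `v`, and a chart `χ : P → R` by a finitely generated, saturated, spanning `P ⊆ ℤⁿ` whose face fan is primitively
simplicial, Kato-log-regular at every prime of a basic open `D(g) ∋ w`, with unit face `0` at `w` (`χ(P ∖ 0) ⊆ w`).
[cite: Kato1994, (1.5), Def. (2.1), Prop. (7.1)] [folklore; cite: SGA3, Exp. VIII §4–5] -/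
theorem exists_sharp_affine_chart (k : Type) [Field k] (A : Type) [AddCommGroup A] [Finite A] [DecidableEq A]
    (S : Type) [CommRing S] [Algebra k S] (𝒮 : A → Submodule k S) [GradedAlgebra 𝒮]
    [Algebra.FiniteType k S] [IsRegularRing S] (v : Spec (.of (𝒮 0))) :
    ∃ (R : Type) (_ : CommRing R) (ι : 𝒮 0 →+* R), ι.Etale ∧
      ∃ (w : PrimeSpectrum R), w.asIdeal.comap ι = v.asIdeal ∧
      ∃ (n : ℕ) (P : AddSubmonoid (Fin n → ℤ)) (hP : P.FG) (_ : ∀ (u : Fin n → ℤ) (K : ℕ), 0 < K → K • u ∈ P → u ∈ P)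
        (hspan : Submodule.span ℤ (P : Set (Fin n → ℤ)) = ⊤) (χ : Multiplicative P →* R) (g : R),
        g ∉ w.asIdeal ∧ (∀ (𝔭 : Ideal R) [𝔭.IsPrime], g ∉ 𝔭 → IsLogRegularAt P χ 𝔭) ∧
        (∀ p : P, (p : Fin n → ℤ) ≠ 0 → χ (Multiplicative.ofAdd p) ∈ w.asIdeal) ∧
        (Fan.ofCone (dualCone P) (dualCone_fg P hP) (isSalient_dualCone P hspan)).IsPrimSimplicial := by
  classical
  -- (0) the étale localization `S ↦ S_t` with global units in the unit degrees (as in `…EtaleLocalLogRegular`)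
  have hA : AddMonoid.IsTorsion A := fun a => isOfFinAddOrder_of_finite a
  obtain ⟨wS, hwS⟩ := comap_algebraMap_gradeZero_surjective 𝒮 hA v
  let 𝔔 : Ideal S := wS.asIdeal
  haveI h𝔔prime : 𝔔.IsPrime := wS.isPrime
  have h𝔔v : 𝔔.comap (algebraMap (𝒮 0) S) = v.asIdeal := by
    have h := congrArg PrimeSpectrum.asIdeal hwS
    rwa [PrimeSpectrum.comap_asIdeal] at h
  obtain ⟨B, hB, -⟩ := StabilizerSubgroup.exists_unitDegrees_addSubgroup 𝒮 hA 𝔔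
  obtain ⟨t, ht0, -, hT, hloc⟩ := AwayUnits.exists_away_units (k := k) 𝒮 𝔔 B hB
  let L : Type := Localization.Away t
  obtain ⟨hprime, hcomap, hBL, -, hunitL⟩ := hloc L
  let ℒ : A → Submodule k L := locPiece 𝒮 (Submonoid.powers t) hT L
  letI instℒ : GradedAlgebra ℒ := (nonempty_gradedAlgebra_locPiece 𝒮 _ hT L).some
  set 𝔔L : Ideal L := 𝔔.map (algebraMap S L) with h𝔔L
  haveI : 𝔔L.IsPrime := hprime
  haveI : Algebra.FiniteType k L := by
    show Algebra.FiniteType k (Localization (Submonoid.powers t))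
    infer_instance
  haveI : IsRegularRing L := isRegularRing_localization (Submonoid.powers t)
  let j : 𝒮 0 →+* ℒ 0 := locPieceZeroHom 𝒮 (Submonoid.powers t) hT L
  have hjet : j.Etale := FixedChart.etale_locPieceZeroHom 𝒮 ht0 hT L
  set 𝔮₀ : Ideal (ℒ 0) := 𝔔L.comap (algebraMap (ℒ 0) L) with h𝔮₀
  have h𝔮₀v : 𝔮₀.comap j = v.asIdeal := by
    rw [h𝔮₀, Ideal.comap_comap, ← h𝔔v, ← hcomap, Ideal.comap_comap]
    congr 1
  -- (1) the unit-exponent chart at `𝔔L`, log regular on `D(g)`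
  obtain ⟨N, y, c, -, ψ, hψ, g, hg, hreg⟩ :=
    WildLogRegularNhd.exists_nhd_isLogRegularAt_of_units ℒ 𝔔L B hBL hunitL
  have hc : ∀ l, IsOfFinAddOrder (c l) := fun l => hA (c l)
  -- (2) split the exponents: `y_l ∈ 𝔔L` (non-units) / `y_l ∉ 𝔔L`
  let pI : Fin N → Prop := fun l => y l ∈ 𝔔L
  let e : Fin (Fintype.card {l // pI l}) ⊕ Fin (Fintype.card {l // ¬ pI l}) ≃ Fin N :=
    ((Fintype.equivFin {l // pI l}).symm.sumCongr (Fintype.equivFin {l // ¬ pI l}).symm).trans (Equiv.sumCompl pI)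
  have he₁ : ∀ i, y (e (Sum.inl i)) ∈ 𝔔L := fun i => ((Fintype.equivFin {l // pI l}).symm i).2
  have he₂ : ∀ j', y (e (Sum.inr j')) ∉ 𝔔L := fun j' => ((Fintype.equivFin {l // ¬ pI l}).symm j').2
  -- membership of `ψ(p)` in `𝔮₀`: some non-unit exponent is positive
  have hψ_mem : ∀ p, ψ (Multiplicative.ofAdd p) ∈ 𝔮₀ ↔ ∃ i, 0 < ((p : Fin N → ℤ) (e (Sum.inl i))).toNat := by
    intro p
    rw [h𝔮₀, Ideal.mem_comap]
    change ((ψ (Multiplicative.ofAdd p) : ℒ 0) : L) ∈ 𝔔L ↔ _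
    rw [hψ, Ideal.IsPrime.prod_mem_iff]
    constructor
    · rintro ⟨l, -, hl⟩
      have hne : ((p : Fin N → ℤ) l).toNat ≠ 0 := by
        rintro h0
        rw [h0, pow_zero] at hl
        exact ‹𝔔L.IsPrime›.ne_top ((Ideal.eq_top_iff_one _).mpr hl)
      have hyl : y l ∈ 𝔔L := Ideal.IsPrime.mem_of_pow_mem inferInstance _ hl
      obtain ⟨x, rfl⟩ := e.surjective l
      rcases x with i | j'
      · exact ⟨i, Nat.pos_of_ne_zero hne⟩
      · exact absurd hyl (he₂ j')
    · rintro ⟨i, hi⟩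
      exact ⟨e (Sum.inl i), Finset.mem_univ _, Ideal.pow_mem_of_mem 𝔔L (he₁ i) _ hi⟩
  have hg₀ : g ∉ 𝔮₀ := fun h => hg (Ideal.mem_comap.mp h)
  -- (3) the vertical element and the sharpening package over `R = (S_t)_0[1/ψ(z)]`
  obtain ⟨z, hz₁, hz₂⟩ := SharpChart.exists_vertical e c
  let R₁ : Type := Localization.Away (ψ (Multiplicative.ofAdd z))
  obtain ⟨hιet, w, hw₀, P, hP, hsat, hspan, χ, hgw, hregχ, hfix, hps⟩ :=
    sharp_chart_of_isLocalization e c hc ψ 𝔮₀ hψ_mem g hg₀ hreg z hz₁ hz₂ R₁ j hjet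
  refine ⟨R₁, inferInstance, (algebraMap (ℒ 0) R₁).comp j, hιet, w, ?_, _, P, hP, hsat, hspan, χ,
    algebraMap (ℒ 0) R₁ g, hgw, hregχ, hfix, hps⟩
  rw [← Ideal.comap_comap, hw₀, h𝔮₀v]

/-- **ISOLATED diagonalizable quotient singularities over `K = K̄` are resolvable (tame or wild).** Let `X` be integral, locally
of finite type over an algebraically closed field `K`, with finitely many singular points, each in the image of an étale morphism
`Spec S₀ → X` where `S` is a REGULAR `K`-algebra of finite type graded by a finite abelian group `A` (no restriction on `|A|`)
and `S₀ = 𝒮 0`. Then `X` has a resolution of singularities. [cite: Kato1994, (10.4)] [cite: Kollar2007, §2.2]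
[folklore; cite: SGA3, Exp. VIII §4–5] -/
theorem hasResolution_of_isolated_quotient_charts_of_isAlgClosed (K : Type) [Field K] [IsAlgClosed K]
    (X : Scheme.{0}) [IsIntegral X] (f : X ⟶ Spec (.of K)) [LocallyOfFiniteType f]
    (hfin : (Scheme.regularLocus X)ᶜ.Finite)
    (hq : ∀ x : X, x ∉ Scheme.regularLocus X →
      ∃ (A : Type) (_ : AddCommGroup A) (_ : Finite A) (_ : DecidableEq A)
        (S : Type) (_ : CommRing S) (_ : Algebra K S) (𝒮 : A → Submodule K S)
        (_ : GradedAlgebra 𝒮), Algebra.FiniteType K S ∧ IsRegularRing S ∧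
        ∃ φ : Spec (.of (𝒮 0)) ⟶ X, Etale φ ∧ x ∈ Set.range φ) :
    Scheme.HasResolution X := by
  classical
  refine IsolatedAffineLogRegularChartResolution.hasResolution_of_isolated_affine_logRegular_charts_of_isAlgClosed'
    K X f hfin fun x hx => ?_
  obtain ⟨A, _, _, _, S, _, _, 𝒮, _, hft, hregS, φ, hφ, ⟨v, hv⟩⟩ := hq x hx
  haveI := hft
  haveI := hregS
  haveI := hφ
  obtain ⟨R, _, ι, hιet, w, hw, n, P, hP, hsat, hspan, χ, g, hgw, hreg, hfix, hps⟩ :=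
    exists_sharp_affine_chart K A S 𝒮 v
  haveI : Etale (Spec.map (CommRingCat.ofHom ι)) := (HasRingHomProperty.Spec_iff (P := @Etale)).mpr hιet
  have hw' : Spec.map (CommRingCat.ofHom ι) w = v := by
    apply PrimeSpectrum.ext
    rw [Spec.map_apply, PrimeSpectrum.comap_asIdeal]
    exact hw
  refine ⟨CommRingCat.of R, Spec.map (CommRingCat.ofHom ι) ≫ φ, inferInstance, w, ?_, n, P, hP, hsat, hspan, χ, g,
    hgw, hreg, hfix, hps⟩
  show φ (Spec.map (CommRingCat.ofHom ι) w) = x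
  rw [hw', hv]

/-- **Diagonalizable quotient SURFACE singularities over `K = K̄` are resolvable** — `stub_diagonalizableQuotientResolution` in
dimension `≤ 2` over an algebraically closed field, hypothesis `hq` VERBATIM (tame or wild): the singular locus is finite
(`…DiagQuotientSurface.diagQuotient_surface_singularLocus`), then `hasResolution_of_isolated_quotient_charts_of_isAlgClosed`.
[cite: Kato1994, (10.4)] [cite: Lipman1978, §2] [cite: Kollar2007, §2.2] -/
theorem hasResolution_of_quotient_surface_of_isAlgClosed (K : Type) [Field K] [IsAlgClosed K]
    (X : Scheme.{0}) (g : X ⟶ Spec (.of K)) [IsIntegral X] [LocallyOfFiniteType g] [QuasiCompact g]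
    (hq : ∀ x : X, ∃ (A : Type) (_ : AddCommGroup A) (_ : Finite A) (_ : DecidableEq A)
        (S : Type) (_ : CommRing S) (_ : Algebra K S) (𝒮 : A → Submodule K S)
        (_ : GradedAlgebra 𝒮), Algebra.FiniteType K S ∧ IsRegularRing S ∧
        ∃ φ : Spec (.of (𝒮 0)) ⟶ X, Etale φ ∧ x ∈ Set.range φ ∧
          φ ≫ g = Spec.map (CommRingCat.ofHom (algebraMap K (𝒮 0))))
    (hdim : topologicalKrullDim X ≤ 2) :
    Scheme.HasResolution X := by
  obtain ⟨hfin, -⟩ := DiagQuotientSurface.diagQuotient_surface_singularLocus K X g hq hdim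
  refine hasResolution_of_isolated_quotient_charts_of_isAlgClosed K X g hfin fun x _ => ?_
  obtain ⟨A, iA, fA, dA, S, iS, aS, 𝒮, gS, hft, hreg, φ, hφ, hx, -⟩ := hq x
  exact ⟨A, iA, fA, dA, S, iS, aS, 𝒮, gS, hft, hreg, φ, hφ, hx⟩

end Summit.ResolutionOfSingularities.ResolutionOfSingularities.Theorems.FRationalResolution.IsolatedQuotientResolution

end

/-! ## Appendix (same generation): the stub's binders verbatim -/

noncomputable section

-- single-problem summit: the doubled namespace component is forced
set_option linter.dupNamespace false

namespace Summit.ResolutionOfSingularities.ResolutionOfSingularities.Theorems.FRationalResolution.IsolatedQuotientResolution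

open CategoryTheory AlgebraicGeometry Literature.AlgebraicGeometry.Resolution

/-- **`stub_diagonalizableQuotientResolution` over an algebraically closed field when the singular locus is finite** (binders of
the stub verbatim, plus `IsAlgClosed k` and `(Reg X)ᶜ` finite; e.g. every `X` of dimension `≤ 2`, see
`hasResolution_of_quotient_surface_of_isAlgClosed`). [cite: Kato1994, (10.4)] [cite: Kollar2007, §2.2] -/
theorem stub_diagonalizableQuotientResolution_of_isAlgClosed_of_finite (k : Type) [Field k] [IsAlgClosed k] (X : Scheme.{0})
    (g : X ⟶ Spec (.of k)) [IsIntegral X] [IsSeparated g] [LocallyOfFiniteType g] [QuasiCompact g]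
    (hq : ∀ x : X, ∃ (A : Type) (_ : AddCommGroup A) (_ : Finite A) (_ : DecidableEq A)
        (S : Type) (_ : CommRing S) (_ : Algebra k S) (𝒮 : A → Submodule k S)
        (_ : GradedAlgebra 𝒮), Algebra.FiniteType k S ∧ IsRegularRing S ∧
        ∃ φ : Spec (.of (𝒮 0)) ⟶ X, Etale φ ∧ x ∈ Set.range φ ∧
          φ ≫ g = Spec.map (CommRingCat.ofHom (algebraMap k (𝒮 0))))
    (hfin : (Scheme.regularLocus X)ᶜ.Finite) :
    Scheme.HasResolution X := by
  refine hasResolution_of_isolated_quotient_charts_of_isAlgClosed k X g hfin fun x _ => ?_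
  obtain ⟨A, iA, fA, dA, S, iS, aS, 𝒮, gS, hft, hreg, φ, hφ, hx, -⟩ := hq x
  exact ⟨A, iA, fA, dA, S, iS, aS, 𝒮, gS, hft, hreg, φ, hφ, hx⟩

end Summit.ResolutionOfSingularities.ResolutionOfSingularities.Theorems.FRationalResolution.IsolatedQuotientResolution

end
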